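import Summits.BirchSwinnertonDyer.BirchSwinnertonDyer.Theses.SmallImageMuTransfer
import Summits.BirchSwinnertonDyer.BirchSwinnertonDyer.Theorems.Rank1ResidualX9MuTransfer
import HarnessLib

/-!
# Route `SmallImageMuTransfer` (rung K6 of BSD, leaf `BSDpOnClassX9`): the ASSEMBLY item, proved

`Assembly := MuTransfer → AnalyticMuZeroX9 → SchneiderX9RankOne → PublishedInputsX9 → BSDpOnClassX9`
(item stmt-BirchSwinnertonDyer-19633) is the kernel bridge `bsdpOnClassX9_of_katoMuTransfer`
(`Theorems/Rank1ResidualX9MuTransfer.lean`, p407118) with the eight published binders bundled into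
the conjunction `PublishedInputsX9`: `MuTransfer` is by definition the tree's `KatoMuTransfer`,
`AnalyticMuZeroX9` the tree's `AnalyticMuZeroOnClassX9`, and `SchneiderX9RankOne` is literally the
`hC3` binder of the bridge. Nothing is asserted about any curve: the three cruxes stay hypotheses.
(cell `bsd-smallim`, seat `koly`, gen 4.)
-/

-- the summit and its single problem are both named `BirchSwinnertonDyer` (registry layout D-0017)
set_option linter.dupNamespace false

set_option autoImplicit false

namespace Summit.BirchSwinnertonDyer.BirchSwinnertonDyer.Theorems

open Summit.BirchSwinnertonDyer.BirchSwinnertonDyer.Theses.SmallImageMuTransfer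

/-- **The assembly of route `SmallImageMuTransfer` holds (KERNEL).** From the `μ`-transfer crux
(`MuTransfer` = `Rank1Residual.KatoMuTransfer`), the analytic `μ = 0` on X9 (`AnalyticMuZeroX9` =
`Rank1Residual.AnalyticMuZeroOnClassX9`), Schneider at the rank-`1` X9 pairs (`SchneiderX9RankOne`)
and the conjunction `PublishedInputsX9` of the eight published inputs (BCS 2025 Thm. 1.1.2 (a),
Greenberg 1999 Thm. 4.1, the period unit, Schneider 1985, Perrin-Riou 1987, modularity, the entire
`L`-function, Gross–Zagier–Kolyvagin), the rung-K6 leaf `BSDpOnClassX9` follows by the kernel bridge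
`Rank1Residual.bsdpOnClassX9_of_katoMuTransfer` (both analytic ranks). [cite: Kato2004Asterisque, Thm. 17.4 (3) and 17.13 (p. 280)]
[cite: BurungaleCastellaSkinner2025, Thm. 1.1.2 (a)] [cite: GreenbergLNM1716, Thm. 4.1 (p. 102) and §1 Conj. 1.11] -/
theorem smallImageMuTransfer_Assembly_proof : Summit.BirchSwinnertonDyer.BirchSwinnertonDyer.Theses.SmallImageMuTransfer.Assembly := by
  unfold Summit.BirchSwinnertonDyer.BirchSwinnertonDyer.Theses.SmallImageMuTransfer.Assembly
  intro h1 h2 h3 hP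
  unfold Summit.BirchSwinnertonDyer.BirchSwinnertonDyer.Theses.SmallImageMuTransfer.MuTransfer at h1
  unfold Summit.BirchSwinnertonDyer.BirchSwinnertonDyer.Theses.SmallImageMuTransfer.AnalyticMuZeroX9 at h2
  unfold Summit.BirchSwinnertonDyer.BirchSwinnertonDyer.Theses.SmallImageMuTransfer.SchneiderX9RankOne at h3
  unfold Summit.BirchSwinnertonDyer.BirchSwinnertonDyer.Theses.SmallImageMuTransfer.PublishedInputsX9 at hP
  obtain ⟨hBCS, hGr, h5, hS, hPR, hmodP, hmodL, hGZK⟩ := hP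
  exact Summit.BirchSwinnertonDyer.BirchSwinnertonDyer.Rank1Residual.bsdpOnClassX9_of_katoMuTransfer
    hBCS hGr h5 hS hPR hmodP hmodL hGZK h1 h2 h3

end Summit.BirchSwinnertonDyer.BirchSwinnertonDyer.Theorems
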